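import Summits.Ventures.PercRepro.RankLevelSetPerElemCircuit

/-! # RankLevelSetPerElemSkeleton — THE SKELETON OF (★★) AT EVERY LEVEL: FREE SETS, AND THE ABSORBING SETS
CIRCUIT BY CIRCUIT (night-1 g36; dossier §48.12; on `RankLevelSetPerElemCircuit`)

The per-element inequality `#{Z ∈ D_j : y ∉ Z} ≤ #{Q ∈ D_{j+1} : y ∈ Q}` splits its left side into the FREE sets
(`y ∉ cl Z`), which inject by `Z ↦ insert y Z` into the through-`y` sets whose complement does not span `y`
(`free_le`), and the ABSORBING sets, grouped by the circuit `K = C_y(Z)` of `y`; the right side contains the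
through-`y` sets whose complement spans `y`, grouped by the circuit of `y` in the complement. If every circuit
class has at most as many members as targets (the hypothesis of **`absorb_le_of_perCircuit`**, summed over the
circuits with `Finset.card_eq_sum_card_image`), the inequality follows (**`perElemAt_of_perCircuit`**). With
`perCircuit_le` this is (★★) at level `j` on coloop-free matroids at elements in no parallel pair whenever every
absorbing member has a circuit with `#K + 1 ≥ j` (**`perElemAt_of_coloopFree_of_circuits`**). Every declaration
has a docstring; imports: the cell's own modules and Mathlib only. Axioms: standard. -/

namespace PercRepro

open Set Matroid

variable {α : Type} (M : Matroid α) [M.Finite]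

/-! ## The free sets -/

/-- **The free bi-independent `j`-sets avoiding `y` inject into the bi-independent `(j+1)`-sets through `y` whose
complement does not span `y`** (`Z ↦ insert y Z`; `free_three_le` at every level). -/
lemma free_le {y : α} (hy : y ∈ M.E) (j : ℕ) :
    {Z ∈ biIndep M j | y ∉ Z ∧ M.Indep (insert y Z)}.ncard ≤
      {Q ∈ biIndep M (j + 1) | y ∈ Q ∧ M.Indep (insert y (M.E \ Q))}.ncard := by
  refine Set.ncard_le_ncard_of_injOn (fun Z => insert y Z) ?_ ?_
    ((biIndep_finite M (j + 1)).subset (fun Q hQ => hQ.1))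
  · rintro Z ⟨⟨hZE, hZj, -, hcind⟩, hyZ, hind⟩
    have hZfin : Z.Finite := M.ground_finite.subset hZE
    have hcompl : M.E \ insert y Z = (M.E \ Z) \ {y} := by
      ext x; simp only [Set.mem_sdiff, Set.mem_insert_iff, Set.mem_singleton_iff, not_or]; tauto
    refine ⟨⟨Set.insert_subset hy hZE, ?_, hind, ?_⟩, Set.mem_insert y Z, ?_⟩
    · rw [Set.ncard_insert_of_notMem hyZ hZfin, hZj]
    · rw [hcompl]; exact hcind.subset Set.sdiff_subset
    · rw [hcompl, Set.insert_sdiff_singleton]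
      have hyE : y ∈ M.E \ Z := ⟨hy, hyZ⟩
      rw [Set.insert_eq_of_mem hyE]; exact hcind
  · rintro Z₁ ⟨-, hy₁, -⟩ Z₂ ⟨-, hy₂, -⟩ heq
    have heq' : insert y Z₁ = insert y Z₂ := heq
    have : (insert y Z₁) \ {y} = (insert y Z₂) \ {y} := by rw [heq']
    rwa [Set.insert_sdiff_of_mem _ (Set.mem_singleton y), Set.insert_sdiff_of_mem _ (Set.mem_singleton y),
      Set.sdiff_singleton_eq_self hy₁, Set.sdiff_singleton_eq_self hy₂] at this

/-! ## The absorbing sets, circuit by circuit -/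

/-- **The absorbing `j`-sets are at most the through-`y` `(j+1)`-sets whose complement spans `y`**, given the
per-circuit inequality for every circuit class (summed over the circuits). -/
lemma absorb_le_of_perCircuit {y : α} (j : ℕ)
    (hK : ∀ Z₀ ∈ lowAbsorbAt M y j,
      {Z ∈ lowAbsorbAt M y j | M.fundCircuit y Z = M.fundCircuit y Z₀}.ncard ≤
        {Q ∈ biIndep M (j + 1) | y ∈ Q ∧ ¬ M.Indep (insert y (M.E \ Q)) ∧
          M.fundCircuit y (M.E \ Q) = M.fundCircuit y Z₀}.ncard) :
    (lowAbsorbAt M y j).ncard ≤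
      {Q ∈ biIndep M (j + 1) | y ∈ Q ∧ ¬ M.Indep (insert y (M.E \ Q))}.ncard := by
  classical
  set f : Set α → Set α := fun Z => M.fundCircuit y Z with hf
  set g : Set α → Set α := fun Q => M.fundCircuit y (M.E \ Q) with hg
  have hmfin : (lowAbsorbAt M y j).Finite := lowAbsorbAt_finite M y j
  have htfin : {Q ∈ biIndep M (j + 1) | y ∈ Q ∧ ¬ M.Indep (insert y (M.E \ Q))}.Finite :=
    (biIndep_finite M (j + 1)).subset (fun Q hQ => hQ.1)
  set A := hmfin.toFinset with hA
  set B := htfin.toFinset with hB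
  have hcardA : ∀ K, (A.filter (fun Z => f Z = K)).card = {Z ∈ lowAbsorbAt M y j | f Z = K}.ncard := by
    intro K
    rw [← Set.ncard_coe_finset, Finset.coe_filter]
    congr 1
    ext Z
    simp only [Set.mem_setOf_eq, hA, Set.Finite.mem_toFinset]
  have hcardB : ∀ K, (B.filter (fun Q => g Q = K)).card =
      {Q ∈ biIndep M (j + 1) | y ∈ Q ∧ ¬ M.Indep (insert y (M.E \ Q)) ∧ g Q = K}.ncard := by
    intro K
    rw [← Set.ncard_coe_finset, Finset.coe_filter]
    congr 1
    ext Q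
    simp only [Set.mem_setOf_eq, hB, Set.Finite.mem_toFinset]
    tauto
  have h1 : A.card = ∑ K ∈ A.image f, (A.filter (fun Z => f Z = K)).card := Finset.card_eq_sum_card_image f A
  have h2 : (B.filter (fun Q => g Q ∈ A.image f)).card =
      ∑ K ∈ A.image f, ((B.filter (fun Q => g Q ∈ A.image f)).filter (fun Q => g Q = K)).card :=
    Finset.card_eq_sum_card_fiberwise (fun Q hQ => (Finset.mem_filter.mp hQ).2)
  have h3 : ∀ K ∈ A.image f, (A.filter (fun Z => f Z = K)).card ≤
      ((B.filter (fun Q => g Q ∈ A.image f)).filter (fun Q => g Q = K)).card := by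
    intro K hK'
    obtain ⟨Z₀, hZ₀A, rfl⟩ := Finset.mem_image.mp hK'
    have hZ₀ : Z₀ ∈ lowAbsorbAt M y j := hmfin.mem_toFinset.mp hZ₀A
    have hsub : B.filter (fun Q => g Q = f Z₀) ⊆
        (B.filter (fun Q => g Q ∈ A.image f)).filter (fun Q => g Q = f Z₀) := by
      intro Q hQ
      rw [Finset.mem_filter] at hQ
      rw [Finset.mem_filter, Finset.mem_filter]
      exact ⟨⟨hQ.1, hQ.2 ▸ hK'⟩, hQ.2⟩
    calc (A.filter (fun Z => f Z = f Z₀)).card = {Z ∈ lowAbsorbAt M y j | f Z = f Z₀}.ncard := hcardA _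
      _ ≤ {Q ∈ biIndep M (j + 1) | y ∈ Q ∧ ¬ M.Indep (insert y (M.E \ Q)) ∧ g Q = f Z₀}.ncard := hK Z₀ hZ₀
      _ = (B.filter (fun Q => g Q = f Z₀)).card := (hcardB _).symm
      _ ≤ _ := Finset.card_le_card hsub
  have h4 : (B.filter (fun Q => g Q ∈ A.image f)).card ≤ B.card :=
    Finset.card_le_card (Finset.filter_subset _ _)
  have h5 : A.card ≤ B.card := by
    rw [h1]
    refine le_trans (Finset.sum_le_sum h3) ?_
    rw [← h2]
    exact h4
  rw [Set.ncard_eq_toFinset_card _ hmfin, Set.ncard_eq_toFinset_card _ htfin]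
  exact h5

/-! ## The skeleton -/

/-- **THE SKELETON OF (★★) AT LEVEL `j`**: if every circuit class of absorbing `j`-sets has at most as many
members as targets, then `#{Z ∈ D_j : y ∉ Z} ≤ #{Q ∈ D_{j+1} : y ∈ Q}`. -/
theorem perElemAt_of_perCircuit {y : α} (hy : y ∈ M.E) (j : ℕ)
    (hK : ∀ Z₀ ∈ lowAbsorbAt M y j,
      {Z ∈ lowAbsorbAt M y j | M.fundCircuit y Z = M.fundCircuit y Z₀}.ncard ≤
        {Q ∈ biIndep M (j + 1) | y ∈ Q ∧ ¬ M.Indep (insert y (M.E \ Q)) ∧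
          M.fundCircuit y (M.E \ Q) = M.fundCircuit y Z₀}.ncard) :
    {Z ∈ biIndep M j | y ∉ Z}.ncard ≤ {Q ∈ biIndep M (j + 1) | y ∈ Q}.ncard := by
  have hL : {Z ∈ biIndep M j | y ∉ Z} =
      {Z ∈ biIndep M j | y ∉ Z ∧ M.Indep (insert y Z)} ∪ lowAbsorbAt M y j := by
    ext Z
    simp only [Set.mem_setOf_eq, Set.mem_union, lowAbsorbAt]
    constructor
    · rintro ⟨hZ, hyZ⟩
      by_cases hind : M.Indep (insert y Z)
      · exact Or.inl ⟨hZ, hyZ, hind⟩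
      · exact Or.inr ⟨hZ, hyZ, hind⟩
    · rintro (⟨hZ, hyZ, -⟩ | ⟨hZ, hyZ, -⟩) <;> exact ⟨hZ, hyZ⟩
  have hd1 : Disjoint {Z ∈ biIndep M j | y ∉ Z ∧ M.Indep (insert y Z)} (lowAbsorbAt M y j) := by
    rw [Set.disjoint_left]
    rintro Z ⟨-, -, hind⟩ ⟨-, -, hdep⟩
    exact hdep hind
  have hfinj : ∀ S : Set (Set α), S ⊆ biIndep M j → S.Finite := fun S hS => (biIndep_finite M j).subset hS
  have hfinj1 : ∀ S : Set (Set α), S ⊆ biIndep M (j + 1) → S.Finite :=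
    fun S hS => (biIndep_finite M (j + 1)).subset hS
  rw [hL, Set.ncard_union_eq hd1 (hfinj _ (fun Z hZ => hZ.1)) (hfinj _ (fun Z hZ => hZ.1))]
  have hsub : {Q ∈ biIndep M (j + 1) | y ∈ Q ∧ M.Indep (insert y (M.E \ Q))} ∪
      {Q ∈ biIndep M (j + 1) | y ∈ Q ∧ ¬ M.Indep (insert y (M.E \ Q))} ⊆ {Q ∈ biIndep M (j + 1) | y ∈ Q} := by
    rintro Q (⟨hQ, hyQ, -⟩ | ⟨hQ, hyQ, -⟩) <;> exact ⟨hQ, hyQ⟩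
  have he1 : Disjoint {Q ∈ biIndep M (j + 1) | y ∈ Q ∧ M.Indep (insert y (M.E \ Q))}
      {Q ∈ biIndep M (j + 1) | y ∈ Q ∧ ¬ M.Indep (insert y (M.E \ Q))} := by
    rw [Set.disjoint_left]
    rintro Q ⟨-, -, hind⟩ ⟨-, -, hdep⟩
    exact hdep hind
  have hR := Set.ncard_le_ncard hsub (hfinj1 _ (fun Q hQ => hQ.1))
  rw [Set.ncard_union_eq he1 (hfinj1 _ (fun Q hQ => hQ.1)) (hfinj1 _ (fun Q hQ => hQ.1))] at hR
  have h1 := free_le M hy j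
  have h2 := absorb_le_of_perCircuit M j hK
  omega

/-- **(★★) AT LEVEL `j` ON A COLOOP-FREE MATROID AT AN ELEMENT IN NO PARALLEL PAIR**, whenever every absorbing
`j`-set has a circuit with `#K + 1 ≥ j` (`2 ≤ j`, `2j + 1 < #E`). -/
theorem perElemAt_of_coloopFree_of_circuits (hcol : ∀ e, ¬ M.IsColoop e) {y : α} (hy : y ∈ M.E) {j : ℕ}
    (hj : 2 ≤ j) (hn : 2 * j + 1 < M.E.ncard)
    (hcirc : ∀ Z₀ ∈ lowAbsorbAt M y j, j ≤ (M.fundCircuit y Z₀).ncard + 1) :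
    {Z ∈ biIndep M j | y ∉ Z}.ncard ≤ {Q ∈ biIndep M (j + 1) | y ∈ Q}.ncard :=
  perElemAt_of_perCircuit M hy j (fun Z₀ hZ₀ => perCircuit_le M hcol hy hj hn hZ₀ (hcirc Z₀ hZ₀))

end PercRepro
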